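import Summits.ResolutionOfSingularities.ResolutionOfSingularities.Theorems.MarkedTransferCampaignW46FiniteExitBound
import Mathlib.RingTheory.RegularLocalRing.Defs
import HarnessLib

/-!
# [OURS · L1 W4.6 rung (iii)] THE SURFACE MOH WINDOW `z^b + f(x,y)`, `b < ord f < 2b`, WITH ISOLATED SINGULAR LOCUS AT
# EVERY STAGE — regime and rung statements (statement-only typing + nesting)

Everything here is OURS: campaign DEFINITIONS over the W4.6 shared vocabulary (`CampaignW46.Regime`, `AmbientDatum`,
`PermissiblyTerminates`, `FinLocalExitBound`, `Terminates`, `TerminatesNabla`) plus pure-logic nesting lemmas. Nothing here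
is a statement of Hironaka's manuscript; no typed `Hironaka2017` candidate enters; no `Literature.…` FACT is used. Typed by
res-L1-type-o1 (OURS typer o1, gen 6, 2026-08-27) as the STATEMENT of RUNG MAP item (iii-2) («the surface window needs a
statement first») for the tranche-1 rung-(iii) provers res-L1-s46-pv-12 / pv-13 (res-plan-2 §1i 2026-08-27T04:09:11Z),
as the unit NAMED for the D→L conversion pool (res-plan-2 D→L MAP v1.5 2026-08-27T04:47:31Z (1)/(4) and v1.6 04:52:12Z (3):
«o1's MohWindowSurface unit»; o1 DRAFT-READY 04:43:36Z, INTENT-TO-FILE 04:47:59Z, unopposed at 05:05Z). Host: MarkedTransfer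
`HypersurfaceOrderReduction` (stmt-ResolutionOfSingularities-16155, §S-s46: rungs (iii)/(iv)), `--supports … --as helper`.
ROUTE-INDEPENDENT module (no `Theses/…` import).

WHAT IS TYPED
* `CampaignW46.MohWindowSurfaceAt b R I` (ring level, res-L1-s46-pv-5's `MohWindowAt` ONE EMBEDDING DIMENSION UP): `R` is a
  regular local ring of embedding dimension `3` and, for some regular system of parameters `(x, y, z)`, some `d` with
  `b < d < 2b` and some `f ∈ (x, y)^d ∖ 𝔪^(d+1)`, `I = (z^b + f)` — the surface germ «`z^b = f(x, y)` with `b < ord f < 2b`»;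
  for `b = p` the purely inseparable surfaces of RESCUE-SEED W4.6 (iii).
* `CampaignW46.Regime.mohWindowSurfaceIsolated` — read on the state `(Z, E)` at EVERY stage (DESIGN POINT (REG)): `Sing(E)` is
  a finite set of closed points (`Regime.isolatedSing`, rung (i-a)'s conjunct) and at every `ξ ∈ Sing(E)` the stalk `J_ξ` is a
  surface window germ of exponent `E.b`; `CampaignW46.Regime.bEqChar` (`E.b = p`) and the conjunction
  `CampaignW46.regimeMohWindowSurfaceInsep` (the purely inseparable case `b = p`).
* RUNG STATEMENTS, résumé-free and strongest first, for both regimes: `MohWindowSurface[Insep]PermissiblyTerminates p K`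
  (`PermissiblyTerminates`: NO infinite §2.1-permissible sequence all of whose stages lie in the regime) and the EXIT-BOUND
  FORM `MohWindowSurface[Insep]FinLocalExitBound p K` (`FinLocalExitBound`, rung (i-a)′'s shape: a bound `β(A₀, E₀, x)` on the
  number of centres over `x` along every FINITE permissible sequence inside the regime).
* NESTING (pure logic): exit bound ⇒ résumé-free rung (pigeonhole over the finite `Sing`,
  `permissiblyTerminates_of_finLocalExitBound`) ⇒ `Terminates N Rd` and `TerminatesNabla N Rd` on the regime for EVERY notion
  instance `N` and reading `Rd` (so the typed Th. 16.6 procedure, whatever its résumés, terminates while it stays in the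
  window); general `b` ⇒ `b = p` (antitonicity in the regime).

DESIGN POINTS (disclosed for the lanes and the provers)
(REG) the window and isolatedness are HYPOTHESES ON EVERY STAGE (RESCUE-SEED W4.6 (iii): «state the window as a hypothesis on
  EVERY step, not only the first»); runs that leave the regime are not spoken about. Outside: the barrier
  `Literature.Barriers.ResolutionOfSingularities.ResidualOrderUnboundedNarrow.mohStability_fails_for_each_e` (ord `p^e`,
  `e ≥ 3`, ≥ 4 variables) and `ResidualOrderUnbounded.hauserPerlega_mohProofBoundFails` — neither applies inside embedding
  dimension 3 with the window re-imposed at each stage; nothing is claimed there.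
(ISO) ISOLATEDNESS IS LOAD-BEARING: with a CURVE of `b`-fold points the literal centre rule admits point centres ON the curve
  and in-window point blow-ups need not terminate — res-L1-s46-pv-6's kernel witnesses `…MohWindowShadeFixedPoint.lean` (p =
  2, `F = u²y + y³ + u²y³ = y·(u + y + uy)²`) and `…MohWindowShadeCycle.lean` (every `p`, `F = u^p y ± y^(p+1) + u^p y^(p+1) =
  y·(u ± y + uy)^p`) both carry a curve of `p`-fold points (`h²`, resp. `h^p` by Frobenius), so `Regime.isolatedSing` excludes
  them; in the isolated regime every permissible centre is a single closed point
  (`IsPermissibleCentre.exists_eq_singleton_of_isolatedSing`).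
(PUR) PURITY READING: «`f = f(x, y)`» is read at ring level as `f ∈ (Ideal.span {x, y})^d` (an IDEAL power: terms `z·x^d` of
  order `≥ d + 1`… are admitted) with `f ∉ 𝔪^(d+1)` (so `ord f = d` exactly). res-L1-s46-pv-5 recorded that «f free of z» is
  not expressible without coordinates/completion; this reading is the coordinate-dependent surrogate (∃ r.s.p.). A prover who
  needs the strict purely-inseparable normal form asks for a sharper sibling (pure append).
(WIN) `b` is `E.b`, not forced to be `p` in the general regime (as in pv-5's curve window); the `Insep` regime adds `E.b = p`.
(VAC) VACUITY / STRENGTH SELF-CHECK (typer). Not trivially true: the regime is inhabited at every prime — candidate kernel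
  witness (prover content, RUNG MAP (iii-1) pattern): `(𝔸³_K, ((z^p + x^(p+1) + y^(p+1)), p))`: order `p` at the origin only
  (first partials `(p+1)x^p`, `(p+1)y^p` force `x = y = 0`, then `z = 0`), `d = p + 1 ∈ (p, 2p)`; and in-window isolated states
  with arbitrarily long in-window point-blow-up chains exist (res-L1-s46-pv-6 HANDOFF: stalls at origin moves, e.g.
  `3x⁵y + 4x⁴y^N`, p = 5), so `β` must depend on fine germ data and the rung is NOT closed by a point count (contrast pv-5's
  curve rung, closed by `#Sing`). Not trivially false: no in-tree refutation; the literature's route is a secondary invariant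
  (Hauser–Wagner 2014 height/bonus: tree file `Resolution/PointBlowupHeightVectorDrops.lean`, named fact
  `Literature.AlgebraicGeometry.Resolution.HauserWagner2014`, UNPROVED in the tree; Hauser–Perlega 2024 `(d, n, s)`) — the
  rung is an OURS proof TARGET, falsifiable by a single in-regime infinite permissible sequence.

AI-WRITTEN; NO expert review; AI review is weaker than expert review. H. Hironaka, ms. 2017-03-23, Th. 16.6 p.84 l.4–20,
Th. 16.13 p.87 l.26–28, §2.1 p.4 l.35–39, Def. 2.1 p.5 — scope only, under adjudication, not cited as fact. [Hironaka2017]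
References: `…W46MohWindow.lean` (pv-5 p472581: `MohWindowAt`, `Regime.mohWindowCurve` — the curve window, CLOSED by
`mohWindowCurveTerminates_holds`), `…W46PlaneIsolated.lean` (pv-1: `Regime.isolatedSing`), `…W46FiniteExitBound.lean` (o1:
`FinLocalExitBound`), `…W46MohWindowShade*.lean` (pv-6: the polynomial shade model, decrease laws p489375/p489977, Hasse test,
FixedPoint/Cycle/NoInvariant negatives), plan/RESCUE-SEED.md §1 W4.6, L/res-L1-type-o1/RUNG-MAP-W46.md (iii-2).
-/

noncomputable section

set_option linter.dupNamespace false -- mandated namespace of this single-conjunct summit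

open CategoryTheory AlgebraicGeometry TopologicalSpace IsLocalRing

namespace Summit.ResolutionOfSingularities.ResolutionOfSingularities.Theorems

namespace CampaignW46

open Literature.AlgebraicGeometry.Resolution
open Literature.AlgebraicGeometry.Hironaka2017.S02Preliminaries
open Literature.AlgebraicGeometry.Hironaka2017.Datum

universe u

/-! ## §1 The surface window predicate (ring level) -/

/-- [OURS · L1 W4.6 rung (iii)] replaces the role of the hypothesis «purely inseparable SURFACE `z^p = f(x, y)` with
`ord f < 2p`» (RESCUE-SEED W4.6 (iii), the dimension-3 reading) READ IN THE STALK at a singular point; NOT a statement of the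
manuscript. For a local ring `R` (= `𝒪_{Z,ξ}`), an ideal `I ⊆ R` (= `J_ξ`) and an exponent `b` (= the `b` of `E = (J, b)`):
`R` is a regular local ring of embedding dimension `3`, and for some regular system of parameters `(x, y, z)` of `R`, some `d`
with `b < d < 2b` and some `f ∈ (x, y)^d` with `f ∉ 𝔪^(d+1)` (so `ord f = d`; DESIGN POINT (PUR): `(x, y)^d` is the ideal
power), `I = (z^b + f)` — the surface germ «`z^b = f(x, y)`, `b < ord f < 2b`». res-L1-s46-pv-5's `MohWindowAt` one embedding
dimension up. [folklore] -/
def MohWindowSurfaceAt (b : ℕ) (R : Type u) [CommRing R] [IsLocalRing R] (I : Ideal R) : Prop :=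
  IsRegularLocalRing R ∧ (maximalIdeal R).spanFinrank = 3 ∧
    ∃ x y z : R, Ideal.span {x, y, z} = maximalIdeal R ∧
      ∃ (d : ℕ) (f : R), b < d ∧ d < 2 * b ∧ f ∈ Ideal.span {x, y} ^ d ∧ f ∉ maximalIdeal R ^ (d + 1) ∧
        I = Ideal.span {z ^ b + f}

/-! ## §2 The regimes -/

variable {n : ℕ} {p : ℕ} [Fact p.Prime] {K : Type u} [Field K] [CharP K p]

/-- [OURS · L1 W4.6 rung (iii)] **Regime «surface Moh window, isolated singular locus»** — replaces the role of the
restriction (iii) of RESCUE-SEED W4.6 in dimension 3, read on the state `(Z, E)` of the typed Th. 16.6 procedure at EVERY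
stage (DESIGN POINTS (REG), (ISO)); NOT a statement of the manuscript: `Sing(E)` (row 001, `{ξ | b ≤ ord_ξ J}`) is a finite set
of closed points of `Z` (`Regime.isolatedSing`) and at every `ξ ∈ Sing(E)` the stalk `J_ξ ⊆ 𝒪_{Z,ξ}` (`stalkIdeal`) is a surface
window germ of exponent `E.b` (`MohWindowSurfaceAt`). [folklore] -/
def Regime.mohWindowSurfaceIsolated : Regime p K := fun A E =>
  Regime.isolatedSing A E ∧ ∀ ξ ∈ E.sing, MohWindowSurfaceAt E.b (A.Z.presheaf.stalk ξ) (stalkIdeal E.J ξ)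

/-- [OURS · L1 W4.6] replaces the role of the qualifier «purely inseparable (`z^p = f`, exponent `p`)» of RESCUE-SEED W4.6
(iii) as a regime conjunct: the exponent is the characteristic, `E.b = p` (DESIGN POINT (WIN)); NOT a statement of the
manuscript. [folklore] -/
def Regime.bEqChar : Regime p K := fun _ E => E.b = p

/-- [OURS · L1 W4.6 rung (iii)] **Regime «purely inseparable surface window»**: `Regime.mohWindowSurfaceIsolated` with
`E.b = p` — the germs `z^p + f(x, y)`, `p < ord f < 2p`, isolated singular point, at every stage; NOT a statement of the
manuscript. [folklore] -/
def regimeMohWindowSurfaceInsep : Regime p K :=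
  Regime.inter Regime.mohWindowSurfaceIsolated Regime.bEqChar

/-- Unfolding the regime. [folklore] -/
theorem Regime.mohWindowSurfaceIsolated_iff (A : AmbientDatum p K) (E : IdealExponent A.Z) :
    Regime.mohWindowSurfaceIsolated A E ↔
      (E.sing.Finite ∧ E.sing ⊆ Literature.AlgebraicGeometry.Hironaka2017.S02Preliminaries.closedPoints A.Z) ∧
        ∀ ξ ∈ E.sing, MohWindowSurfaceAt E.b (A.Z.presheaf.stalk ξ) (stalkIdeal E.J ξ) :=
  Iff.rfl

/-- Unfolding the purely inseparable regime. [folklore] -/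
theorem regimeMohWindowSurfaceInsep_iff (A : AmbientDatum p K) (E : IdealExponent A.Z) :
    regimeMohWindowSurfaceInsep A E ↔ Regime.mohWindowSurfaceIsolated A E ∧ E.b = p :=
  Iff.rfl

/-- In the regime the singular locus is finite (the hypothesis of the pigeonhole assembly). [folklore] -/
theorem Regime.mohWindowSurfaceIsolated.sing_finite {A : AmbientDatum p K} {E : IdealExponent A.Z}
    (h : Regime.mohWindowSurfaceIsolated A E) : E.sing.Finite :=
  h.1.1

/-- The purely inseparable regime is contained in the general one. [folklore] -/
theorem regimeMohWindowSurfaceInsep_le (A : AmbientDatum p K) (E : IdealExponent A.Z)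
    (h : regimeMohWindowSurfaceInsep A E) : Regime.mohWindowSurfaceIsolated A E :=
  h.1

/-! ## §3 The rung statements -/

/-- [OURS · L1 W4.6 rung (iii)] **RUNG (iii), SURFACE WINDOW, résumé-free** — replaces the role of the termination clause of
Th. 16.13 p.87 l.26–28 («repeatedly but finitely many times») for the surface window with isolated singular locus imposed at
every stage; NOT a statement of the manuscript: there is NO infinite §2.1-permissible sequence (standard ideal exponents,
permissible centres — here single closed points —, blow-ups, controlled transforms) all of whose stages lie in
`Regime.mohWindowSurfaceIsolated` (`PermissiblyTerminates`). VACUITY: module docstring (VAC). [folklore] -/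
def MohWindowSurfacePermissiblyTerminates (p : ℕ) [Fact p.Prime] (K : Type u) [Field K] [CharP K p] : Prop :=
  PermissiblyTerminates (Regime.mohWindowSurfaceIsolated (p := p) (K := K))

/-- [OURS · L1 W4.6 rung (iii)] **RUNG (iii), SURFACE WINDOW, EXIT-BOUND FORM** (rung (i-a)′'s shape `FinLocalExitBound`) —
replaces the role of the same termination clause as a bound: there is `β(A, E, x)` such that along every FINITE permissible
sequence inside `Regime.mohWindowSurfaceIsolated` at most `β(A₀, E₀, x)` centres lie over each point `x` of stage `0`; NOT a
statement of the manuscript. By (VAC) `β` must see fine germ data (arbitrarily long in-window chains exist). It implies the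
résumé-free rung (`mohWindowSurfacePermissiblyTerminates_of_finLocalExitBound`). [folklore] -/
def MohWindowSurfaceFinLocalExitBound (p : ℕ) [Fact p.Prime] (K : Type u) [Field K] [CharP K p] : Prop :=
  FinLocalExitBound (Regime.mohWindowSurfaceIsolated (p := p) (K := K))

/-- [OURS · L1 W4.6 rung (iii)] **RUNG (iii), PURELY INSEPARABLE SURFACE WINDOW (`b = p`), résumé-free**: no infinite
§2.1-permissible sequence inside `regimeMohWindowSurfaceInsep`; NOT a statement of the manuscript. Implied by the general-`b`
rung (`mohWindowSurfaceInsepPermissiblyTerminates_of_general`). [folklore] -/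
def MohWindowSurfaceInsepPermissiblyTerminates (p : ℕ) [Fact p.Prime] (K : Type u) [Field K] [CharP K p] : Prop :=
  PermissiblyTerminates (regimeMohWindowSurfaceInsep (p := p) (K := K))

/-- [OURS · L1 W4.6 rung (iii)] **RUNG (iii), PURELY INSEPARABLE SURFACE WINDOW (`b = p`), EXIT-BOUND FORM**:
`FinLocalExitBound regimeMohWindowSurfaceInsep`; NOT a statement of the manuscript. [folklore] -/
def MohWindowSurfaceInsepFinLocalExitBound (p : ℕ) [Fact p.Prime] (K : Type u) [Field K] [CharP K p] : Prop :=
  FinLocalExitBound (regimeMohWindowSurfaceInsep (p := p) (K := K))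

/-! ## §4 Nesting (pure logic) -/

/-- Pure logic + pigeonhole (`permissiblyTerminates_of_finLocalExitBound`, `Sing` finite in the regime): the exit-bound form
gives the résumé-free rung. [folklore] -/
theorem mohWindowSurfacePermissiblyTerminates_of_finLocalExitBound (h : MohWindowSurfaceFinLocalExitBound p K) :
    MohWindowSurfacePermissiblyTerminates p K :=
  permissiblyTerminates_of_finLocalExitBound (fun _ _ hRg => hRg.1.1) h

/-- The same in the purely inseparable regime. [folklore] -/
theorem mohWindowSurfaceInsepPermissiblyTerminates_of_finLocalExitBound (h : MohWindowSurfaceInsepFinLocalExitBound p K) :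
    MohWindowSurfaceInsepPermissiblyTerminates p K :=
  permissiblyTerminates_of_finLocalExitBound (fun _ _ hRg => hRg.1.1.1) h

/-- Pure logic (antitonicity in the regime): the general-`b` résumé-free rung gives the `b = p` one. [folklore] -/
theorem mohWindowSurfaceInsepPermissiblyTerminates_of_general (h : MohWindowSurfacePermissiblyTerminates p K) :
    MohWindowSurfaceInsepPermissiblyTerminates p K :=
  permissiblyTerminates_antitone (fun A E hAE => regimeMohWindowSurfaceInsep_le A E hAE) h

/-- Pure logic (antitonicity in the regime): the general-`b` exit bound gives the `b = p` one (same `β`). [folklore] -/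
theorem mohWindowSurfaceInsepFinLocalExitBound_of_general (h : MohWindowSurfaceFinLocalExitBound p K) :
    MohWindowSurfaceInsepFinLocalExitBound p K := by
  obtain ⟨β, hβ⟩ := h
  exact ⟨β, fun r hr x s hs => hβ r (fun k hk => (hr k hk).1) x s hs⟩

/-- **The typed rungs from the résumé-free rung**: for EVERY notion instance `N` and reading `Rd`, the typed Th. 16.6
procedure with the literal centre rule (`Terminates`) and the ∇-centred one (`TerminatesNabla`) have no infinite run inside the
surface window regime. [folklore] -/
theorem terminates_and_terminatesNabla_of_mohWindowSurfacePermissiblyTerminates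
    (h : MohWindowSurfacePermissiblyTerminates p K) (n : ℕ) (N : Notions.{u} n) (Rd : Reading p K N) :
    Terminates N Rd (Regime.mohWindowSurfaceIsolated (p := p) (K := K)) ∧
      TerminatesNabla N Rd (Regime.mohWindowSurfaceIsolated (p := p) (K := K)) :=
  ⟨terminates_of_permissiblyTerminates N Rd h, terminatesNabla_of_terminates (terminates_of_permissiblyTerminates N Rd h)⟩

/-- The same in the purely inseparable regime. [folklore] -/
theorem terminates_and_terminatesNabla_of_mohWindowSurfaceInsepPermissiblyTerminates
    (h : MohWindowSurfaceInsepPermissiblyTerminates p K) (n : ℕ) (N : Notions.{u} n) (Rd : Reading p K N) :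
    Terminates N Rd (regimeMohWindowSurfaceInsep (p := p) (K := K)) ∧
      TerminatesNabla N Rd (regimeMohWindowSurfaceInsep (p := p) (K := K)) :=
  ⟨terminates_of_permissiblyTerminates N Rd h, terminatesNabla_of_terminates (terminates_of_permissiblyTerminates N Rd h)⟩


/-! ## §5 v2 APPEND (2026-08-27, res-D-pv-050 AS res-L1-s46-pv-12's WORD 05:14:22Z): the COEFFICIENT presentation, the TAME
## sub-regime (no heavy root of the residual binary form), `E.b = p`, and the rung the prover attacks —
## `MohWindowSurfaceTameTerminates p K` (+ ∇ twin, + résumé-free form). PURE APPEND: §1–§4 byte-identical to v1 (p498940).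
## The prover's proof plan (hand proof complete, STATUS 05:14:22Z): at a tame window point the minimal residual order of every
## singular child satisfies d″ ≤ d − b + mult_P(φ) < d (φ = the residue binary form of the degree-d part), off the centre d is
## transported, so the MULTISET of residual orders over Sing(E) drops in the Dershowitz–Manna order at every admitted step; the
## HEAVY-ROOT case (a root of φ of multiplicity ≥ b — unique and rational) is EXCLUDED here and is res-D-pv-008 AS s46-pv-14's
## piece (H) (res-plan-2 D→L MAP v1.10a (2)); the NON-VACUITY instance is res-D-pv-029's p499871 (piece (NV)). -/

/-- [OURS · L1 W4.6 rung (iii)] replaces the role of the hypothesis «purely inseparable SURFACE `z^p = f(x, y)`, `ord f < 2p`» READ IN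
THE STALK, **COEFFICIENT PRESENTATION** (res-L1-s46-pv-12's WORD 05:14:22Z (a): «what the proof consumes/produces»); NOT a statement of
the manuscript: `R` regular local of embedding dimension `3`; for some regular system of parameters `(x, y, z)`, some `d` with
`b < d < 2b` and some coefficient sequence `a : ℕ → R` with a UNIT among `a 0, …, a d`,
`I = (z^b + Σ_{j ≤ d} a_j x^(d−j) y^j)`. Equivalent in a regular local ring to the ideal-power reading `MohWindowSurfaceAt` (prover's
remark; not proved here). [folklore] -/
def MohWindowSurfaceCoeffAt (b : ℕ) (R : Type u) [CommRing R] [IsLocalRing R] (I : Ideal R) : Prop :=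
  IsRegularLocalRing R ∧ (maximalIdeal R).spanFinrank = 3 ∧
    ∃ x y z : R, Ideal.span {x, y, z} = maximalIdeal R ∧
      ∃ (d : ℕ) (a : ℕ → R), b < d ∧ d < 2 * b ∧ (∃ j ≤ d, IsUnit (a j)) ∧
        I = Ideal.span {z ^ b + ∑ j ∈ Finset.range (d + 1), a j * x ^ (d - j) * y ^ j}

/-- [OURS · L1 W4.6 rung (iii)] replaces the role of the same hypothesis IN THE **TAME** CASE (res-L1-s46-pv-12's WORD (a)): the
coefficient presentation `MohWindowSurfaceCoeffAt` with TWO more conjuncts inside the ∃-block — the residue binary form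
`φ = Σ ā_j X^(d−j) Y^j ∈ κ[X, Y]_d` has NO `κ`-RATIONAL LINEAR FACTOR OF MULTIPLICITY `≥ b` on either affine line (x-chart
dehomogenisation `Σ ā_j X^j` and y-chart dehomogenisation `Σ ā_j X^(d−j)`). RELABEL v4 (docstring-only supersede 2026-08-27, on
OURS-desk #108 v2 lane B res-L1-ref-b2 PARTIAL 05:33:27Z; Lean term unchanged): the clause excludes EXACTLY THE `κ`-RATIONAL HEAVY-ROOT
CASE. SEPARABLE non-rational roots have multiplicity `< b` automatically (`d < 2b`); but over an IMPERFECT residue field `κ` a purely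
inseparable factor `(X − sY)^p` with `s^p ∈ κ ∖ κ^p` — a heavy root over `κ̄`, multiplicity `p = b` — is NOT excluded (lane-B witness
over `K = 𝔽_p(t)`: `z^p + (x^p − t·y^p)(x + y)`, `d = p + 1`, tame as typed, `φ = (X + Y)(X − t^(1/p) Y)^p` over `κ̄`; at the child
over that root the residual order does NOT drop and the child carries a `κ`-RATIONAL heavy root, i.e. it LEAVES this regime). So: over a
PERFECT `K` (closed points of finite-type `K`-schemes have perfect residue fields) the whole heavy-root case is excluded; over imperfect
`K` the inseparable-heavy states are admitted and disclosed — the prover's multiset descent needs that extra case (no drop, but exit from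
the regime), or a `[PerfectField K]` sibling (typed on the prover's word). The earlier parenthetical «non-rational roots have
multiplicity `< b` automatically since `d < 2b`» and «unique and rational» are WITHDRAWN as stated. The `κ`-rational heavy-root case
(where the residual order can stall or grow and a Hauser–Wagner-type secondary invariant is needed) is EXCLUDED and named (piece (H));
NOT a statement of the manuscript. [folklore] -/
def MohWindowSurfaceTameAt (b : ℕ) (R : Type u) [CommRing R] [IsLocalRing R] (I : Ideal R) : Prop :=
  IsRegularLocalRing R ∧ (maximalIdeal R).spanFinrank = 3 ∧
    ∃ x y z : R, Ideal.span {x, y, z} = maximalIdeal R ∧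
      ∃ (d : ℕ) (a : ℕ → R), b < d ∧ d < 2 * b ∧ (∃ j ≤ d, IsUnit (a j)) ∧
        I = Ideal.span {z ^ b + ∑ j ∈ Finset.range (d + 1), a j * x ^ (d - j) * y ^ j} ∧
        (∀ t : IsLocalRing.ResidueField R, ¬ (Polynomial.X - Polynomial.C t) ^ b ∣
            ∑ j ∈ Finset.range (d + 1), Polynomial.C (IsLocalRing.residue R (a j)) * Polynomial.X ^ j) ∧
        (∀ s : IsLocalRing.ResidueField R, ¬ (Polynomial.X - Polynomial.C s) ^ b ∣
            ∑ j ∈ Finset.range (d + 1), Polynomial.C (IsLocalRing.residue R (a j)) * Polynomial.X ^ (d - j))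

/-- Pure logic: a tame window presentation is a window presentation (drop the two root conjuncts). [folklore] -/
theorem MohWindowSurfaceTameAt.coeff {b : ℕ} {R : Type u} [CommRing R] [IsLocalRing R] {I : Ideal R}
    (h : MohWindowSurfaceTameAt b R I) : MohWindowSurfaceCoeffAt b R I := by
  obtain ⟨hR, hdim, x, y, z, hm, d, a, hbd, hd2b, hunit, hI, -, -⟩ := h
  exact ⟨hR, hdim, x, y, z, hm, d, a, hbd, hd2b, hunit, hI⟩

/-- [OURS · L1 W4.6 rung (iii)] **Regime «purely inseparable surface window, coefficient presentation»** (res-L1-s46-pv-12's WORD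
(b) `Regime.mohWindowSurface`): `E.b = p` (USED by the proof — the characteristic enters through `(λz₁ + αx + q)^p`), `Sing(E)` a
finite set of closed points (so every permissible centre is a single closed point), and at every `ξ ∈ Sing(E)` the stalk `J_ξ` has a
coefficient window presentation of exponent `E.b`; at EVERY stage (DESIGN POINT (REG)); NOT a statement of the manuscript. [folklore] -/
def Regime.mohWindowSurface : Regime p K := fun A E =>
  E.b = p ∧ E.sing.Finite ∧ E.sing ⊆ Literature.AlgebraicGeometry.Hironaka2017.S02Preliminaries.closedPoints A.Z ∧
    ∀ ξ ∈ E.sing, MohWindowSurfaceCoeffAt E.b (A.Z.presheaf.stalk ξ) (stalkIdeal E.J ξ)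

/-- [OURS · L1 W4.6 rung (iii)] **Regime «purely inseparable TAME surface window»** (res-L1-s46-pv-12's WORD (b)
`Regime.mohWindowSurfaceTame`): as `Regime.mohWindowSurface` with the TAME presentation `MohWindowSurfaceTameAt` at every singular
point, at every stage; the `κ`-RATIONAL heavy-root case excluded and named — the WHOLE heavy-root case when `K` is perfect;
inseparable-heavy states over imperfect `K` admitted and disclosed (RELABEL v4, see `MohWindowSurfaceTameAt`; Lean term unchanged);
NOT a statement of the manuscript. [folklore] -/
def Regime.mohWindowSurfaceTame : Regime p K := fun A E =>
  E.b = p ∧ E.sing.Finite ∧ E.sing ⊆ Literature.AlgebraicGeometry.Hironaka2017.S02Preliminaries.closedPoints A.Z ∧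
    ∀ ξ ∈ E.sing, MohWindowSurfaceTameAt E.b (A.Z.presheaf.stalk ξ) (stalkIdeal E.J ξ)

/-- Pure logic: the tame regime is contained in the coefficient-window regime. [folklore] -/
theorem Regime.mohWindowSurfaceTame_le (A : AmbientDatum p K) (E : IdealExponent A.Z) (h : Regime.mohWindowSurfaceTame A E) :
    Regime.mohWindowSurface A E :=
  ⟨h.1, h.2.1, h.2.2.1, fun ξ hξ => (h.2.2.2 ξ hξ).coeff⟩

/-- In the tame regime the singular locus is finite (the pigeonhole / multiset hypothesis). [folklore] -/
theorem Regime.mohWindowSurfaceTame.sing_finite {A : AmbientDatum p K} {E : IdealExponent A.Z}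
    (h : Regime.mohWindowSurfaceTame A E) : E.sing.Finite :=
  h.2.1

/-- [OURS · L1 W4.6 rung (iii)] **RUNG (iii), TAME SURFACE WINDOW — the statement res-L1-s46-pv-12 attacks** (WORD 05:14:22Z (b)):
replaces the role of the termination clause of Th. 16.13 p.87 l.26–28 («repeatedly but finitely many times») for the TYPED Th. 16.6
procedure restricted, at every stage, to the purely inseparable tame surface window with isolated singular locus; NOT a statement of
the manuscript: for EVERY notion instance `N` and EVERY reading `Rd` there is no infinite run of the typed procedure all of whose stages
lie in `Regime.mohWindowSurfaceTame` (`CampaignW46.Terminates`). The universal quantification over `N`, `Rd` is contentful exactly as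
in pv-5's curve rung (`MohWindowCurveTerminates`): the proof uses of a run only the blow-up structure, the transform law and
`D ⊆ Sing(E)` (point centres are FORCED by finiteness), and the multiset of residual orders drops at every admitted step. No exit-bound
form is typed (prover: «the multiset argument gives no honest numeric β without a child-count lemma — later»). VACUITY: inhabited —
res-D-pv-029's instance p499871 `(𝔸³, z^p + x^(p+1) + y^(p+1))` is tame (φ = X^(p+1) + Y^(p+1) is separable for p ∤ p+1); not
trivially true (arbitrarily long tame chains exist); `κ`-rational heavy-root states excluded by hypothesis; over IMPERFECT `K`
inseparable-heavy tame states are admitted (RELABEL v4: their child over the inseparable root keeps the residual order but is no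
longer tame — lane-B witness — so a run through it is not «in the regime at every stage»; the statement is NOT refuted by it),
disclosed. EXPECTED CLOSER SHAPE (res-plan-2 SLOT-PLANNER WORD 05:33:54Z preference (i), realised at the PROOF level — no new decl
needed): `theorem … (p) [Fact p.Prime] (K) [Field K] [CharP K p] [PerfectField K] : MohWindowSurfaceTameTerminates p K`; the
imperfect-`K` instances of this Prop stay admitted/open as disclosed. [folklore] -/
def MohWindowSurfaceTameTerminates (p : ℕ) [Fact p.Prime] (K : Type u) [Field K] [CharP K p] : Prop :=
  ∀ (n : ℕ) (N : Notions.{u} n) (Rd : Reading p K N), Terminates N Rd (Regime.mohWindowSurfaceTame (p := p) (K := K))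

/-- [OURS · L1 W4.6 rung (iii)] the ∇-CENTRED twin of `MohWindowSurfaceTameTerminates` (`TerminatesNabla`, every `N`, `Rd`); NOT a
statement of the manuscript. Implied by the literal-rule form (`mohWindowSurfaceTameTerminatesNabla_of_terminates`). [folklore] -/
def MohWindowSurfaceTameTerminatesNabla (p : ℕ) [Fact p.Prime] (K : Type u) [Field K] [CharP K p] : Prop :=
  ∀ (n : ℕ) (N : Notions.{u} n) (Rd : Reading p K N), TerminatesNabla N Rd (Regime.mohWindowSurfaceTame (p := p) (K := K))

/-- [OURS · L1 W4.6 rung (iii)] the RÉSUMÉ-FREE (strongest) form in the tame regime: no infinite §2.1-permissible sequence inside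
`Regime.mohWindowSurfaceTame` (`PermissiblyTerminates`); NOT a statement of the manuscript. Optional target: the prover's multiset
descent is stated for every ADMITTED point centre, so it plausibly proves this form too; it implies the two typed forms
(`mohWindowSurfaceTameTerminates_of_permissibly`). [folklore] -/
def MohWindowSurfaceTamePermissiblyTerminates (p : ℕ) [Fact p.Prime] (K : Type u) [Field K] [CharP K p] : Prop :=
  PermissiblyTerminates (Regime.mohWindowSurfaceTame (p := p) (K := K))

/-- Pure logic: the literal-rule rung gives the ∇-centred rung. [folklore] -/
theorem mohWindowSurfaceTameTerminatesNabla_of_terminates (h : MohWindowSurfaceTameTerminates p K) :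
    MohWindowSurfaceTameTerminatesNabla p K :=
  fun n N Rd => terminatesNabla_of_terminates (h n N Rd)

/-- Pure logic: the résumé-free form gives the typed rung for every `N`, `Rd`. [folklore] -/
theorem mohWindowSurfaceTameTerminates_of_permissibly (h : MohWindowSurfaceTamePermissiblyTerminates p K) :
    MohWindowSurfaceTameTerminates p K :=
  fun _ N Rd => terminates_of_permissiblyTerminates N Rd h


/-! ## §6 v3 APPEND (2026-08-27, res-D-pv-008 AS res-L1-s46-pv-14's TYPING ASK 05:18:21Z): the INTRINSIC RESIDUAL ORDER of a
## window ideal — so that the HEAVY-ROOT side (piece (H): stall / growth of the residual order, e.g. the kernel growth witness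
## `z^p + y^(p+1) + x^(p+2) y^(p−1)`, residual order `p+1 ↦ p+2` under the unique admitted centre, every `p ≥ 3`) quantifies over
## nothing. PURE APPEND: §1–§5 byte-identical to v2 (p500688). -/

/-- [OURS · L1 W4.6 rung (iii)] replaces the role of «the residual order `ord f` of a purely inseparable equation `z^b + f`» made
PRESENTATION-FREE (res-D-pv-008 AS res-L1-s46-pv-14's ASK 05:18:21Z, verbatim up to the `⨆` spelling); NOT a statement of the
manuscript: for a local ring `R`, an exponent `b` and an ideal `I`, `residualOrder b R I := sup {n | ∃ w ∈ 𝔪, I ≤ (w^b) + 𝔪^n}`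
in `ℕ∞`. For a window presentation `I = (z^b + f)`, `f ∈ (x, y)^d ∖ 𝔪^(d+1)`, the witness `w = z` gives `≥ d`; the prover's
uniqueness lemma (H1a: `(cz + h)^p = c^p z^p + h^p` in characteristic `p` plus quasi-regularity of an r.s.p.) gives `= d`, so the
window exponent is intrinsic. Degenerate values disclosed: `n = 0` always qualifies (`𝔪^0 = ⊤`), so the value is `≥ 0`; it is `⊤`
iff the condition holds for every `n` (e.g. `I ≤ (w^b)`). [folklore] -/
def residualOrder (b : ℕ) (R : Type u) [CommRing R] [IsLocalRing R] (I : Ideal R) : ℕ∞ :=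
  ⨆ (n : ℕ) (_ : ∃ w ∈ maximalIdeal R, I ≤ Ideal.span {w ^ b} ⊔ maximalIdeal R ^ n), (n : ℕ∞)

/-- Pure logic (`le_iSup₂`): any admissible `n` bounds the residual order from below — the form the provers use (`w := z`,
`n := d` for a window presentation). [folklore] -/
theorem le_residualOrder {b : ℕ} {R : Type u} [CommRing R] [IsLocalRing R] {I : Ideal R} {n : ℕ} {w : R}
    (hw : w ∈ maximalIdeal R) (hI : I ≤ Ideal.span {w ^ b} ⊔ maximalIdeal R ^ n) : (n : ℕ∞) ≤ residualOrder b R I :=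
  le_iSup₂ (f := fun (n : ℕ) (_ : ∃ w ∈ maximalIdeal R, I ≤ Ideal.span {w ^ b} ⊔ maximalIdeal R ^ n) => (n : ℕ∞)) n ⟨w, hw, hI⟩

/-- Pure logic (`iSup₂_le`): an upper bound valid for every admissible `n` bounds the residual order from above — the form the
uniqueness lemma (H1a) uses. [folklore] -/
theorem residualOrder_le {b : ℕ} {R : Type u} [CommRing R] [IsLocalRing R] {I : Ideal R} {m : ℕ∞}
    (h : ∀ (n : ℕ) (w : R), w ∈ maximalIdeal R → I ≤ Ideal.span {w ^ b} ⊔ maximalIdeal R ^ n → (n : ℕ∞) ≤ m) :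
    residualOrder b R I ≤ m :=
  iSup₂_le fun n hn => by
    obtain ⟨w, hw, hI⟩ := hn
    exact h n w hw hI

end CampaignW46

end Summit.ResolutionOfSingularities.ResolutionOfSingularities.Theorems

end
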